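import Summits.MatrixMultiplication.MatrixMultiplication.Theorems.AbelianSTPPCensusShapeCertVPBudgets

/-!
# Abelian STPP census — soundness of `ShapeCertVP` (part 4a: specifications of the checker's components)

Cell mm-stpp, route `AbelianSTPPCensusVP`, crux `ShapeExclusionVP337` (stmt-MatrixMultiplication-19191); seat mm-stpp-theory.
Small numeric facts (the clamped level tables dominate level `27`; `3 ≤ tOf i`; the top-level constant `low_num`), the
checker's prefix quantities as multiset sums over the prefix (`P1Of_eq`, `P2Of_eq`, `fibL_eq`, `crS_eq`, `admRT_spec`),
and the specifications of the budget record (`budsOf_get`, `budT_some`, `tailEmpty_spec`, `clAny_spec`), of the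
Grynkiewicz node selection (`gnode_spec`) and of the break-level binary search (`breakLev_spec`).  Consumed by
`…ShapeCertVPBounds` and `…ShapeCertVPSearch`.
-/

set_option linter.dupNamespace false -- `MatrixMultiplication.MatrixMultiplication` (summit = problem, D-0017)
set_option autoImplicit false

namespace Summit.MatrixMultiplication.MatrixMultiplication.Theorems.ShapeCertVP

open ShapeCert Multiset

section numerics
/-! ### Small numeric facts -/

/-- the top-level inequality, order by order: level-27 ratio times `2.25·M` stays below `10⁶·M·K` -/
theorem low_num : ∀ M ≤ 337, (tabR 27).get 7 * ((3 * M + 3 * (M / 2)) / 2) ≤ M * D * K := by decide +kernel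

/-- the budget parameters are at least `3` -/
theorem three_le_tOf (i : ℕ) : 3 ≤ tOf i := by
  match i with
  | 0 | 1 | 2 | 3 | 4 => decide
  | _ + 5 => exact (by decide : 3 ≤ 32)

/-- levels below `27` read the level-27 row of the ratio table -/
theorem tabR_ge27 (L k : ℕ) : (tabR 27).get k ≤ (tabR L).get k := by
  rcases Nat.lt_or_ge L 27 with h | h
  · have : tabR L = tabR 27 := by unfold tabR; rw [if_pos (by omega), if_pos (by omega), if_pos h]; rfl
    rw [this]
  · exact tabR_mono h k

/-- levels below `27` read the level-27 row of the Grynkiewicz table -/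
theorem tabG_ge27 (L i : ℕ) : (tabG 27).get i ≤ (tabG L).get i := by
  rcases Nat.lt_or_ge L 27 with h | h
  · have : tabG L = tabG 27 := by unfold tabG; rw [if_pos (by omega), if_pos (by omega), if_pos h]; rfl
    rw [this]
  · exact tabG_mono h i

/-- the ratio table at level `L` dominates every shape of level `≤ L` or `≤ 27` -/
theorem rhoT_le_tabR' {M : ℕ} {x : ℕ × ℕ × ℕ} (hM : M ≤ 337) (hx : InUniv M x) {L : ℕ}
    (hL : levT x ≤ 27 ∨ levT x ≤ L) {k : ℕ} (hk : capOK k (vol x) = true) : rhoT x ≤ (tabR L).get k := by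
  rcases hL with hL | hL
  · exact (rhoT_le_tabR hM hx hL hk).trans (tabR_ge27 L k)
  · exact rhoT_le_tabR hM hx hL hk

/-- the Grynkiewicz table at level `L` dominates every shape of level `≤ L` or `≤ 27` -/
theorem qhT_le_tabG' {M : ℕ} {x : ℕ × ℕ × ℕ} (hM : M ≤ 337) (hx : InUniv M x) {L : ℕ}
    (hL : levT x ≤ 27 ∨ levT x ≤ L) (i : ℕ) : qhT x (tOf i) ≤ (tabG L).get i := by
  rcases hL with hL | hL
  · exact (qhT_le_tabG hM hx hL i).trans (tabG_ge27 L i)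
  · exact qhT_le_tabG hM hx hL i

/-- the scaled ratio dominates gain over packing weight: `g·K ≤ rho·uu` -/
theorem gT_mul_le_rho {M : ℕ} {x : ℕ × ℕ × ℕ} (hU : InUniv M x) : gT x * K ≤ rhoT x * uu x := by
  unfold rhoT; rw [Nat.add_mul, Nat.one_mul]
  exact (Nat.lt_div_mul_add hU.uu_pos).le

/-- the scaled Grynkiewicz ratio dominates gain over weight: `g·K ≤ qh_t·ŵ_t` (positive weight) -/
theorem gT_mul_le_qh {x : ℕ × ℕ × ℕ} {t : ℕ} (hw : 0 < whT x t) : gT x * K ≤ qhT x t * whT x t := by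
  unfold qhT; rw [Nat.add_mul, Nat.one_mul]
  exact (Nat.lt_div_mul_add hw).le

end numerics

section translation
/-! ### The checker's prefix quantities as multiset sums -/

variable {M : ℕ} {fam : List Sh}

/-- `P₁` of the aggregates -/
theorem P1Of_eq (hw : WfV M fam) (r : ℕ) : P1Of r (aggOf M fam) = ((famT fam).map (p1T r)).sum := by
  match r with
  | 0 => exact sab_eqV hw
  | 1 => exact sca_eqV hw
  | r + 2 => exact sbc_eqV hw

/-- `P₂` of the aggregates -/
theorem P2Of_eq (hw : WfV M fam) (r : ℕ) : P2Of r (aggOf M fam) = ((famT fam).map (p2T r)).sum := by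
  match r with
  | 0 => exact sbc_eqV hw
  | 1 => exact sab_eqV hw
  | r + 2 => exact sca_eqV hw

/-- the fibre sum of a prefix -/
theorem fibL_eq (hw : WfV M fam) (r t : ℕ) : fibL r t fam = ((famT fam).map (fibT r t)).sum :=
  agg_sum_eqV hw _ _ fun x => by simp [fibT]

/-- the credit sum of a prefix -/
theorem crS_eq (hw : WfV M fam) (r t : ℕ) : crS r t fam = ((famT fam).map (crT r t)).sum :=
  agg_sum_eqV hw _ _ fun x => by simp [crT]

/-- what an admissible `(r, t)` means for the prefix multiset -/
theorem admRT_spec (hw : WfV M fam) {r t : ℕ} (h : admRT r t (aggOf M fam) fam = true) :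
    3 ≤ t ∧ t ≤ ((famT fam).map (p1T r)).sum ∧ t ≤ ((famT fam).map (p2T r)).sum ∧
      t ≤ ((famT fam).map (fibT r t)).sum := by
  unfold admRT at h
  simp only [Bool.and_eq_true, decide_eq_true_eq] at h
  rw [P1Of_eq hw, P2Of_eq hw, fibL_eq hw] at h
  exact ⟨h.1.1.1, h.1.1.2, h.1.2, h.2⟩

/-- no parameter is admissible for the empty prefix -/
theorem admRT_nil (r t : ℕ) (A : Agg) (ht : 3 ≤ t) : admRT r t A [] = false := by
  unfold admRT fibL
  simp only [List.map_nil, List.sum_nil]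
  have : ¬ t ≤ 0 := by omega
  simp [this]

/-- the budgets of the empty prefix are all absent -/
theorem budsOf_nil (M : ℕ) (A : Agg) : budsOf M A [] = ⟨none, none, none, none, none, none⟩ := by
  have h : ∀ t, 3 ≤ t → budT M t A [] = none := by
    intro t ht; unfold budT budRT; simp [admRT_nil _ t A ht]; rfl
  unfold budsOf
  rw [h _ (three_le_tOf 0), h _ (three_le_tOf 1), h _ (three_le_tOf 2), h _ (three_le_tOf 3),
    h _ (three_le_tOf 4), h _ (three_le_tOf 5)]

/-- components of the budget record -/
theorem budsOf_get (M : ℕ) (A : Agg) (fam : List Sh) (i : ℕ) : (budsOf M A fam).get i = budT M (tOf i) A fam := by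
  match i with
  | 0 | 1 | 2 | 3 | 4 => rfl
  | _ + 5 => rfl

/-- a budget at `t` is the budget of some admissible form -/
theorem budT_some {t : ℕ} {A : Agg} {b : ℕ} (h : budT M t A fam = some b) :
    ∃ r, admRT r t A fam = true ∧ b = t * M + 2 * (t * t) - 1 + crS r t fam - t * uuA A := by
  unfold budT at h
  have key : ∀ r, ∀ c, budRT M r t A fam = some c →
      admRT r t A fam = true ∧ c = t * M + 2 * (t * t) - 1 + crS r t fam - t * uuA A := by
    intro r c hc; unfold budRT at hc
    by_cases ha : admRT r t A fam = true
    · rw [if_pos ha, Option.some.injEq] at hc; exact ⟨ha, hc.symm⟩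
    · rw [if_neg ha] at hc; exact absurd hc (by simp)
  rcases h0 : budRT M 0 t A fam with _ | c0 <;> rcases h1 : budRT M 1 t A fam with _ | c1 <;>
    rcases h2 : budRT M 2 t A fam with _ | c2 <;> rw [h0, h1, h2] at h <;> simp only [omin, Option.some.injEq] at h
  · exact absurd h (by simp)
  · exact ⟨2, key 2 b (by rw [h2, h])⟩
  · exact ⟨1, key 1 b (by rw [h1, h])⟩
  · rcases min_choice c1 c2 with e | e <;> rw [e] at h
    · exact ⟨1, key 1 b (by rw [h1, h])⟩
    · exact ⟨2, key 2 b (by rw [h2, h])⟩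
  · exact ⟨0, key 0 b (by rw [h0, h])⟩
  · rcases min_choice c0 c2 with e | e <;> rw [e] at h
    · exact ⟨0, key 0 b (by rw [h0, h])⟩
    · exact ⟨2, key 2 b (by rw [h2, h])⟩
  · rcases min_choice c0 c1 with e | e <;> rw [e] at h
    · exact ⟨0, key 0 b (by rw [h0, h])⟩
    · exact ⟨1, key 1 b (by rw [h1, h])⟩
  · rcases min_choice c1 c2 with e | e <;> rw [e] at h <;> rcases min_choice c0 _ with e' | e' <;> rw [e'] at h
    · exact ⟨0, key 0 b (by rw [h0, h])⟩
    · exact ⟨1, key 1 b (by rw [h1, h])⟩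
    · exact ⟨0, key 0 b (by rw [h0, h])⟩
    · exact ⟨2, key 2 b (by rw [h2, h])⟩

/-- what `tailEmpty` certifies -/
theorem tailEmpty_spec {B : Buds} (h : B.tailEmpty = true) : ∃ i b, B.get i = some b ∧ b ≤ 2 * tOf i := by
  unfold Buds.tailEmpty at h
  simp only [Bool.or_eq_true] at h
  have key : ∀ i (o : Option ℕ), beEmpty i o = true → ∃ b, o = some b ∧ b ≤ 2 * tOf i := by
    intro i o ho; cases o with
    | none => exact absurd ho (by simp [beEmpty])
    | some b => exact ⟨b, rfl, by simpa [beEmpty] using ho⟩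
  rcases h with ((((h | h) | h) | h) | h) | h
  · obtain ⟨b, hb, hle⟩ := key 0 _ h; exact ⟨0, b, hb, hle⟩
  · obtain ⟨b, hb, hle⟩ := key 1 _ h; exact ⟨1, b, hb, hle⟩
  · obtain ⟨b, hb, hle⟩ := key 2 _ h; exact ⟨2, b, hb, hle⟩
  · obtain ⟨b, hb, hle⟩ := key 3 _ h; exact ⟨3, b, hb, hle⟩
  · obtain ⟨b, hb, hle⟩ := key 4 _ h; exact ⟨4, b, hb, hle⟩
  · obtain ⟨b, hb, hle⟩ := key 5 _ h; exact ⟨5, b, hb, hle⟩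

/-- what `clAny` certifies -/
theorem clAny_spec {B : Buds} {g0 mdk L : ℕ} (h : B.clAny g0 mdk L = true) :
    ∃ i b, B.get i = some b ∧ g0 + b * (tabG L).get i ≤ mdk := by
  unfold Buds.clAny at h
  simp only [Bool.or_eq_true] at h
  have key : ∀ i (o : Option ℕ), beCl g0 mdk L i o = true → ∃ b, o = some b ∧ g0 + b * (tabG L).get i ≤ mdk := by
    intro i o ho; cases o with
    | none => exact absurd ho (by simp [beCl])
    | some b => exact ⟨b, rfl, by simpa [beCl] using ho⟩
  rcases h with ((((h | h) | h) | h) | h) | h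
  · obtain ⟨b, hb, hle⟩ := key 0 _ h; exact ⟨0, b, hb, hle⟩
  · obtain ⟨b, hb, hle⟩ := key 1 _ h; exact ⟨1, b, hb, hle⟩
  · obtain ⟨b, hb, hle⟩ := key 2 _ h; exact ⟨2, b, hb, hle⟩
  · obtain ⟨b, hb, hle⟩ := key 3 _ h; exact ⟨3, b, hb, hle⟩
  · obtain ⟨b, hb, hle⟩ := key 4 _ h; exact ⟨4, b, hb, hle⟩
  · obtain ⟨b, hb, hle⟩ := key 5 _ h; exact ⟨5, b, hb, hle⟩

/-- the selection invariant of `gpick`: a found selection is one of the budgets -/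
theorem gpick_inv (L : ℕ) (B : Buds) {cur : GSel} (hcur : cur.ok = true → B.get cur.idx = some cur.bud) (i : ℕ) :
    (gpick L cur i (B.get i)).ok = true → B.get (gpick L cur i (B.get i)).idx = some (gpick L cur i (B.get i)).bud := by
  unfold gpick
  cases hB : B.get i with
  | none => simpa [hB] using hcur
  | some b =>
    simp only [seqN_eq]
    split_ifs with hc
    · exact hcur
    · intro _; exact hB

/-- the node's Grynkiewicz selection is one of the budgets -/
theorem gnode_spec (L : ℕ) (B : Buds) (h : (gnode L B).ok = true) : B.get (gnode L B).idx = some (gnode L B).bud := by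
  have e : gnode L B = gpick L (gpick L (gpick L (gpick L (gpick L (gpick L ⟨false, 0, 0, 0⟩
      0 (B.get 0)) 1 (B.get 1)) 2 (B.get 2)) 3 (B.get 3)) 4 (B.get 4)) 5 (B.get 5) := rfl
  rw [e] at h ⊢
  refine gpick_inv L B (gpick_inv L B (gpick_inv L B (gpick_inv L B (gpick_inv L B (gpick_inv L B ?_ 0) 1) 2) 3) 4) 5 h
  intro h0; exact absurd h0 (by simp)

/-- the binary search keeps «`l = 27` or `p (l − 1)`» -/
theorem bsearch_inv (p : ℕ → Bool) : ∀ (n l h : ℕ), (l = 27 ∨ p (l - 1) = true) →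
    (bsearch p n l h = 27 ∨ p (bsearch p n l h - 1) = true)
  | 0, l, h, hl => by rw [bsearch]; exact hl
  | n + 1, l, h, hl => by
    rw [bsearch]
    by_cases h1 : h ≤ l
    · rw [if_pos h1]; exact hl
    · rw [if_neg h1]
      simp only
      by_cases h2 : p ((l + h) / 2) = true
      · rw [if_pos h2]; exact bsearch_inv p n _ _ (Or.inr (by simpa using h2))
      · rw [if_neg h2]; exact bsearch_inv p n _ _ hl

/-- what a break level certifies: at level `lb1 − 1 ≥ 27` one of the two bounds closes -/
theorem breakLev_spec {g0 q : ℕ} {sel : B8 → ℕ} {mdk : ℕ} {gb : Bool} {gB gi lb1 : ℕ}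
    (h : breakLev g0 q sel mdk gb gB gi = lb1) (h0 : lb1 ≠ 0) :
    27 ≤ lb1 - 1 ∧ (g0 + sel (tabR (lb1 - 1)) * q ≤ mdk ∨ (gb = true ∧ g0 + gB * (tabG (lb1 - 1)).get gi ≤ mdk)) := by
  unfold breakLev at h
  simp only [seqN_eq] at h
  set r := bsearch (fun L => decide (g0 + sel (tabR L) * q ≤ mdk)) 6 27 55 with hr
  set g := (if gb then bsearch (fun L => decide (g0 + gB * (tabG L).get gi ≤ mdk)) 6 27 55 else 27) with hg
  have hR := bsearch_inv (fun L => decide (g0 + sel (tabR L) * q ≤ mdk)) 6 27 55 (Or.inl rfl)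
  rw [← hr] at hR
  by_cases hm : max r g ≤ 27
  · rw [if_pos hm] at h; exact absurd h.symm h0
  · rw [if_neg hm] at h
    rw [← h]
    rcases le_total g r with hgr | hgr
    · rw [max_eq_left hgr] at hm ⊢
      refine ⟨by omega, Or.inl ?_⟩
      rcases hR with hR | hR
      · omega
      · simpa using hR
    · rw [max_eq_right hgr] at hm ⊢
      refine ⟨by omega, Or.inr ?_⟩
      cases gb with
      | false => simp only [Bool.false_eq_true, ↓reduceIte] at hg; omega
      | true =>
        simp only [↓reduceIte] at hg
        have hG := bsearch_inv (fun L => decide (g0 + gB * (tabG L).get gi ≤ mdk)) 6 27 55 (Or.inl rfl)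
        rw [← hg] at hG
        rcases hG with hG | hG
        · omega
        · exact ⟨rfl, by simpa using hG⟩

end translation

end Summit.MatrixMultiplication.MatrixMultiplication.Theorems.ShapeCertVP
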